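import Summits.CriticalPhenomena.Ising3DConformalLimit.Theses.InverseSquareTelemetry
import Summits.CriticalPhenomena.Ising3DConformalLimit.Theorems.InverseSquareTelemetryEtaBoundsFromTelemetryBarriers
import Literature.Probability.LatticeModels.CriticalTwoPointBounds
import HarnessLib

/-!
# Crux `InverseSquareLaw` (stmt-CriticalPhenomena-4495), line `registered` — stub S2
# `stub_unitarityFromInfraredBound`: the telemetric constant is nonnegative

Route `InverseSquareTelemetry`, sub-problem `Ising3DConformalLimit`; THEOREM-ONLY helper file,
`--supports stmt-CriticalPhenomena-4495` (stub S2 of the registered skeleton `Lines/birth.lean`).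

Write `G = criticalTwoPoint 3` (`⟨σ₀σ_x⟩⁺_{β_c}` on `ℤ³`), `s(x) = ∑ᵢ xᵢ² = |x|₂²`,
`Δ` for the six-neighbour Laplacian `latticeLaplacianZd` and `T(x) = s(x) · (ΔG)(x)/G(x)` for the
telemetry. **Statement (S2, `TelemetricUnitarity`).** If `|T(x) - κ| ≤ C |x|₂^{-ε}` for all but
finitely many `x` (`ε > 0`), then `0 ≤ κ`.

**Proof.** Suppose `κ < 0` and put `k = min(-κ/2, 1/8) > 0`. Far out the hypothesis gives
`T(x) ≤ κ + |C| s^{-ε/2} ≤ -k`, i.e. `ΔG ≤ Ṽ G` with the EXACT model potential `Ṽ = -k/s`: the positive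
function `G` is a supersolution of `Δ - Ṽ` on an exterior region `E = {s ≥ S₀}`. For this potential
the lattice Taylor expansion `Δ s^{-p} = 2p(2p-1) s^{-p-1} + O(s^{-p-3/2})`
(`latticeLaplacianZd_rpow_neg`) shows that `h = s^{-1/4}` is a positive supersolution
(`2·¼·(½-1) = -1/4 < -k`) and `u = s^{-q}`, `q = 1/2 - k/4`, a subsolution
(`2q(2q-1) = -k/2 + k²/4 > -k`). The tree's `h`-transform comparison principle
`sub_le_super_of_hTransform` (boundary values on the finite shell `∂E ⊆ {S₀/4 ≤ s < S₀}`, decay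
`u = o(h)` since `q > 1/4`) gives `m s^{-q} ≤ G` on `E` for some `m > 0`, which contradicts the
infrared bound `G ≤ C₀‖x‖⁻¹ ≤ C₀√3 · s^{-1/2}` (`criticalTwoPoint_bounds_holds`) because `q < 1/2`
(`no_negative_coupling`). No Hardy-threshold case distinction is needed: the hypothesis is used
one-sidedly, so `κ ≤ -1/4` only makes `ΔG ≤ -(1/8) G/s` truer.

In CFT language `κ = 2Δ(2Δ-1) ≥ 0` is the unitarity bound `Δ ≥ 1/2`; here it is the lattice
statement that a positive solution decaying at least like `|x|⁻¹` cannot feel an attractive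
inverse-square potential. Method: Murata, Duke Math. J. 53 (1986); Pinchover, J. Differential
Equations 111 (1994); on graphs Keller–Pinchover–Pogorzelski, J. Spectral Theory 10 (2020) §4.2 —
all statements below are elementary consequences of tree theorems and tagged folklore.
-/

noncomputable section

namespace Summit.CriticalPhenomena.Ising3DConformalLimit.Theorems

open Literature.Probability.LatticeModels Finset Set Filter Topology
open Summit.CriticalPhenomena.Ising3DConformalLimit.Theorems.EtaBoundsFromTelemetry

namespace InverseSquareLawUnitarity

/-- **No attractive inverse-square coupling under the infrared bound.** There is no `G : ℤ³ → ℝ`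
with `G > 0` and `G ≤ C₀ s^{-1/2}` off the origin whose Laplacian satisfies `ΔG ≤ -(k/s) G` on an
exterior region `{s ≥ S}`, `0 < k ≤ 1/8` (`s = ∑ᵢ xᵢ²`): the weight `h = s^{-1/4}` and the subsolution
`s^{-q}`, `q = 1/2 - k/4`, of `Δ + k/s` feed `sub_le_super_of_hTransform`, giving `G ≥ m s^{-q}` far
out, incompatible with `G = O(s^{-1/2})`. [folklore] -/
theorem no_negative_coupling {k C₀ S : ℝ} (hk : 0 < k) (hk8 : k ≤ 1 / 8) {G : Site 3 → ℝ}
    (hGpos : ∀ x : Site 3, x ≠ 0 → 0 < G x)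
    (hGup : ∀ x : Site 3, x ≠ 0 → G x ≤ C₀ * (∑ i, ((x i : ℤ) : ℝ) ^ 2) ^ (-(1 / 2 : ℝ)))
    (hsup : ∀ x : Site 3, S ≤ ∑ i, ((x i : ℤ) : ℝ) ^ 2 →
      latticeLaplacianZd G x ≤ -(k / ∑ i, ((x i : ℤ) : ℝ) ^ 2) * G x) : False := by
  obtain ⟨s, hs⟩ : ∃ s : Site 3 → ℝ, ∀ x, s x = ∑ i, ((x i : ℤ) : ℝ) ^ 2 := ⟨_, fun _ => rfl⟩
  simp only [← hs] at hGup hsup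
  have hs0 : s 0 = 0 := by rw [hs]; simp
  have hstend : Tendsto s cofinite atTop := by simpa only [← hs] using tendsto_sumSq_cofinite
  -- the exponent of the subsolution
  set q : ℝ := 1 / 2 - k / 4 with hq
  have hq0 : 0 < q := by rw [hq]; linarith
  have hq4 : 1 / 4 < q := by rw [hq]; linarith
  have hq2 : q < 1 / 2 := by rw [hq]; linarith
  have hqq : 2 * q * (2 * q - 1) = -(k / 2) + k ^ 2 / 4 := by rw [hq]; ring
  obtain ⟨Kq, hKq0, hLq⟩ := latticeLaplacianZd_rpow_neg hq0
  obtain ⟨Kh, hKh0, hLh⟩ := latticeLaplacianZd_rpow_neg (show (0 : ℝ) < 1 / 4 by norm_num)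
  simp only [← hs] at hLq hLh
  -- thresholds
  have hev : ∀ᶠ t : ℝ in atTop, 16 ≤ t ∧ (S ≤ t ∧ (Kh * t ^ (-(1 / 2 : ℝ)) ≤ 1 / 8 ∧
      Kq * t ^ (-(1 / 2 : ℝ)) ≤ k / 2)) :=
    (eventually_ge_atTop 16).and ((eventually_ge_atTop S).and
      ((eventually_mul_rpow_neg_le (by norm_num) _ (by norm_num)).and
      (eventually_mul_rpow_neg_le (by norm_num) _ (by positivity))))
  obtain ⟨S₁, hS₁⟩ := Filter.eventually_atTop.1 hev
  set S₀ : ℝ := 4 * max S₁ 16 with hS₀def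
  have hS₀64 : 64 ≤ S₀ := by
    have : (16 : ℝ) ≤ max S₁ 16 := le_max_right _ _
    rw [hS₀def]; linarith
  have hS₁S₀ : S₁ ≤ S₀ / 4 := by
    have : S₁ ≤ max S₁ 16 := le_max_left _ _
    rw [hS₀def]; linarith
  clear_value S₀
  clear hev hS₀def
  have adm : ∀ x : Site 3, S₀ / 4 ≤ s x → x ≠ 0 ∧ 0 < s x ∧ 1 ≤ s x ∧ 16 ≤ s x ∧ S ≤ s x ∧
      Kh * s x ^ (-(1 / 2 : ℝ)) ≤ 1 / 8 ∧ Kq * s x ^ (-(1 / 2 : ℝ)) ≤ k / 2 := by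
    intro x hx
    obtain ⟨h16, hS, h1, h2⟩ := hS₁ (s x) (hS₁S₀.trans hx)
    have hx0 : x ≠ 0 := by
      rintro rfl
      rw [hs0] at h16
      linarith
    exact ⟨hx0, by linarith, by linarith, h16, hS, h1, h2⟩
  obtain ⟨E, hE⟩ : ∃ E : Set (Site 3), E = {y : Site 3 | S₀ ≤ ∑ i, ((y i : ℤ) : ℝ) ^ 2} :=
    ⟨_, rfl⟩
  have hEmem : ∀ x, x ∈ E ↔ S₀ ≤ s x := fun x => by rw [hE, hs]; rfl
  have hEadm : ∀ x ∈ E ∪ zdOuterBoundary E, S₀ / 4 ≤ s x ∧ s x ≤ S₀ ∨ S₀ ≤ s x := by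
    intro x hx
    rcases hx with hx | hx
    · exact Or.inr ((hEmem x).1 hx)
    · rw [hE] at hx
      obtain ⟨h1, h2⟩ := sumSq_of_mem_zdOuterBoundary hS₀64 hx
      rw [← hs] at h1 h2
      exact Or.inl ⟨h1, h2.le⟩
  clear hE
  have hEadm' : ∀ x ∈ E ∪ zdOuterBoundary E, S₀ / 4 ≤ s x := by
    intro x hx
    rcases hEadm x hx with ⟨h, -⟩ | h
    · exact h
    · linarith
  -- the model potential `Ṽ = -k/s`
  obtain ⟨V, hV⟩ : ∃ V : Site 3 → ℝ, ∀ x, V x = -(k / s x) := ⟨_, fun _ => rfl⟩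
  -- (1) the weight `h = s^{-1/4}` is a positive supersolution of `Δ - Ṽ` on `E`
  have hpos : ∀ x ∈ E ∪ zdOuterBoundary E, 0 < (fun y => s y ^ (-(1 / 4 : ℝ))) x := by
    intro x hx
    have : 0 < s x := by linarith [hEadm' x hx]
    exact Real.rpow_pos_of_pos this _
  have hsuper : ∀ x ∈ E, latticeLaplacianZd (fun y => s y ^ (-(1 / 4 : ℝ))) x ≤
      V x * (fun y => s y ^ (-(1 / 4 : ℝ))) x := by
    intro x hx
    obtain ⟨-, hsx0, hs1, hs16, -, c1, -⟩ := adm x (hEadm' x (Or.inl hx))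
    have hL := hLh x hs16
    have hpow : ∀ a b : ℝ, s x ^ a * s x ^ b = s x ^ (a + b) := fun a b =>
      (Real.rpow_add hsx0 a b).symm
    set H : ℝ := s x ^ (-(1 / 4 : ℝ) - 1) with hH
    set v : ℝ := s x ^ (-(1 / 2 : ℝ)) with hv
    have hH0 : 0 < H := Real.rpow_pos_of_pos hsx0 _
    have e2 : s x ^ (-(1 / 4 : ℝ) - 3 / 2) = v * H := by rw [hv, hH, hpow]; congr 1; ring
    have e4 : s x ^ (-(1 / 4 : ℝ)) = s x * H := by
      calc s x ^ (-(1 / 4 : ℝ)) = s x ^ ((1 : ℝ) + (-(1 / 4 : ℝ) - 1)) := by norm_num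
        _ = s x ^ (1 : ℝ) * s x ^ (-(1 / 4 : ℝ) - 1) := Real.rpow_add hsx0 _ _
        _ = s x * H := by rw [Real.rpow_one]
    rw [e2] at hL
    show latticeLaplacianZd (fun y => s y ^ (-(1 / 4 : ℝ))) x ≤ V x * s x ^ (-(1 / 4 : ℝ))
    rw [e4, hV]
    have e5 : -(k / s x) * (s x * H) = -(k * H) := by field_simp
    rw [e5]
    obtain ⟨-, hL2⟩ := abs_le.1 hL
    have f1 : H * (Kh * v) ≤ H * (1 / 8) := mul_le_mul_of_nonneg_left c1 hH0.le
    have f2 : k * H ≤ (1 / 8) * H := mul_le_mul_of_nonneg_right hk8 hH0.le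
    nlinarith [f1, f2, hL2, hH0]
  -- (2) `u = s^{-q}` is a subsolution of `Δ - Ṽ` on `E`
  have hsub : ∀ x ∈ E, V x * s x ^ (-q) ≤ latticeLaplacianZd (fun y => s y ^ (-q)) x := by
    intro x hx
    obtain ⟨-, hsx0, hs1, hs16, -, -, c2⟩ := adm x (hEadm' x (Or.inl hx))
    have hL := hLq x hs16
    have hpow : ∀ a b : ℝ, s x ^ a * s x ^ b = s x ^ (a + b) := fun a b =>
      (Real.rpow_add hsx0 a b).symm
    set Q : ℝ := s x ^ (-q - 1) with hQ
    set v : ℝ := s x ^ (-(1 / 2 : ℝ)) with hv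
    have hQ0 : 0 < Q := Real.rpow_pos_of_pos hsx0 _
    have e2 : s x ^ (-q - 3 / 2) = v * Q := by rw [hv, hQ, hpow]; congr 1; ring
    have e4 : s x ^ (-q) = s x * Q := by
      calc s x ^ (-q) = s x ^ ((1 : ℝ) + (-q - 1)) := by congr 1; ring
        _ = s x ^ (1 : ℝ) * s x ^ (-q - 1) := Real.rpow_add hsx0 _ _
        _ = s x * Q := by rw [Real.rpow_one]
    rw [e2, hqq] at hL
    rw [e4, hV]
    have e5 : -(k / s x) * (s x * Q) = -(k * Q) := by field_simp
    rw [e5]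
    obtain ⟨hL1, -⟩ := abs_le.1 hL
    have f1 : Q * (Kq * v) ≤ Q * (k / 2) := mul_le_mul_of_nonneg_left c2 hQ0.le
    have f2 : 0 ≤ k ^ 2 / 4 * Q := by positivity
    nlinarith [f1, f2, hL1, hQ0]
  -- (3) `G` is a supersolution of `Δ - Ṽ` on `E`
  have hGsuper : ∀ x ∈ E, latticeLaplacianZd G x ≤ V x * G x := by
    intro x hx
    obtain ⟨-, -, -, -, hS, -⟩ := adm x (hEadm' x (Or.inl hx))
    rw [hV]
    exact hsup x hS
  -- (4) comparison: `m s^{-q} ≤ G` on `E`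
  have hF : {y : Site 3 | s y ≤ S₀}.Finite := by simpa only [← hs] using finite_sumSq_le S₀
  have hbdryF : ∀ y ∈ zdOuterBoundary E, y ∈ {y : Site 3 | s y ≤ S₀} ∧ S₀ / 4 ≤ s y := by
    intro y hy
    rcases hEadm y (Or.inr hy) with ⟨h1, h2⟩ | h
    · exact ⟨h2, h1⟩
    · exact absurd ((hEmem y).2 h) hy.1
  obtain ⟨M, hM0, hM⟩ := exists_le_mul_on_finite hF (fun y => s y ^ (-q)) G
  have hlower : ∀ x ∈ E, M⁻¹ * s x ^ (-q) ≤ G x := by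
    refine sub_le_super_of_hTransform (d := 3) (by norm_num) (E := E) (V := V)
      (u := fun y => M⁻¹ * s y ^ (-q)) (w := G)
      (h := fun y => s y ^ (-(1 / 4 : ℝ))) hpos hsuper ?_ hGsuper ?_ ?_
    · intro x hx
      rw [latticeLaplacianZd_const_mul]
      have h := hsub x hx
      calc V x * (M⁻¹ * s x ^ (-q)) = M⁻¹ * (V x * s x ^ (-q)) := by ring
        _ ≤ M⁻¹ * latticeLaplacianZd (fun y => s y ^ (-q)) x :=
            mul_le_mul_of_nonneg_left h (inv_nonneg.2 hM0.le)
    · intro y hy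
      obtain ⟨hyF, hy4⟩ := hbdryF y hy
      obtain ⟨hy0, -⟩ := adm y hy4
      have h := hM y hyF (hGpos y hy0)
      rw [inv_mul_le_iff₀ hM0]
      exact h
    · intro ε hε
      have hev' : ∀ᶠ x in cofinite, M⁻¹ * s x ^ (-(q - 1 / 4)) ≤ ε :=
        hstend.eventually (eventually_mul_rpow_neg_le (by linarith) M⁻¹ hε)
      filter_upwards [hev'] with x hx hxE
      have hx4 : S₀ / 4 ≤ s x := hEadm' x (Or.inl hxE)
      obtain ⟨hx0, hsx0, -⟩ := adm x hx4
      have hq' : 0 ≤ s x ^ (-(1 / 4 : ℝ)) := Real.rpow_nonneg hsx0.le _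
      have hsplit : s x ^ (-q) = s x ^ (-(q - 1 / 4)) * s x ^ (-(1 / 4 : ℝ)) := by
        rw [← Real.rpow_add hsx0]; congr 1; ring
      have hG0 := hGpos x hx0
      calc M⁻¹ * s x ^ (-q) - G x ≤ M⁻¹ * s x ^ (-q) := by linarith
        _ = M⁻¹ * s x ^ (-(q - 1 / 4)) * s x ^ (-(1 / 4 : ℝ)) := by rw [hsplit, mul_assoc]
        _ ≤ ε * s x ^ (-(1 / 4 : ℝ)) := mul_le_mul_of_nonneg_right hx hq'
  -- (5) contradiction with the infrared bound far out
  have hfar : ∀ᶠ t : ℝ in atTop, S₀ ≤ t ∧ |C₀| * t ^ (-(1 / 2 - q)) ≤ M⁻¹ / 2 :=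
    (eventually_ge_atTop S₀).and
      (eventually_mul_rpow_neg_le (by linarith) _ (half_pos (inv_pos.2 hM0)))
  obtain ⟨S₂, hS₂⟩ := Filter.eventually_atTop.1 hfar
  obtain ⟨N, hN⟩ := exists_nat_ge (max S₂ 1)
  have hN1 : (1 : ℝ) ≤ N := (le_max_right _ _).trans hN
  have hN2 : S₂ ≤ N := (le_max_left _ _).trans hN
  set x : Site 3 := fun _ => (N : ℤ) with hxdef
  have hsxN : s x = 3 * (N : ℝ) ^ 2 := by
    rw [hs, hxdef, Fin.sum_univ_three]
    push_cast
    ring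
  have hsx : S₂ ≤ s x := by rw [hsxN]; nlinarith
  obtain ⟨hS₀x, hCx⟩ := hS₂ (s x) hsx
  have hxE : x ∈ E := (hEmem x).2 hS₀x
  obtain ⟨hx0, hsx0, -⟩ := adm x (by linarith : S₀ / 4 ≤ s x)
  have h1 := hlower x hxE
  have h2 := hGup x hx0
  have hsplit : s x ^ (-(1 / 2 : ℝ)) = s x ^ (-(1 / 2 - q)) * s x ^ (-q) := by
    rw [← Real.rpow_add hsx0]; congr 1; ring
  have hsq0 : 0 < s x ^ (-q) := Real.rpow_pos_of_pos hsx0 _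
  have h3 : G x ≤ |C₀| * s x ^ (-(1 / 2 - q)) * s x ^ (-q) := by
    calc G x ≤ C₀ * s x ^ (-(1 / 2 : ℝ)) := h2
      _ ≤ |C₀| * s x ^ (-(1 / 2 : ℝ)) :=
          mul_le_mul_of_nonneg_right (le_abs_self _) (Real.rpow_nonneg hsx0.le _)
      _ = |C₀| * s x ^ (-(1 / 2 - q)) * s x ^ (-q) := by rw [hsplit, mul_assoc]
  have h4 : |C₀| * s x ^ (-(1 / 2 - q)) * s x ^ (-q) ≤ M⁻¹ / 2 * s x ^ (-q) :=
    mul_le_mul_of_nonneg_right hCx hsq0.le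
  have hMi : 0 < M⁻¹ := inv_pos.2 hM0
  nlinarith [h1, h3, h4, hsq0, hMi]

end InverseSquareLawUnitarity

open InverseSquareLawUnitarity

/-- **Stub S2 of crux `InverseSquareLaw` (stmt-CriticalPhenomena-4495), line `registered`:
unitarity from the infrared bound.** If the telemetry `T(x) = |x|₂² · (Δ_{ℤ³}G)(x)/G(x)` of the
critical two-point function `G = criticalTwoPoint 3` satisfies `|T(x) - κ| ≤ C |x|₂^{-ε}` for all but
finitely many `x ∈ ℤ³` (`ε > 0`), then `0 ≤ κ`. Proof: were `κ < 0`, then with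
`k = min(-κ/2, 1/8)` one has `ΔG ≤ -(k/s) G` far out (`s = |x|₂²`), and `no_negative_coupling`
(barrier `s^{-q}`, weight `s^{-1/4}`, `h`-transform comparison) contradicts the infrared bound
`G ≤ C₀‖x‖⁻¹` of `criticalTwoPoint_bounds_holds` (with `G > 0` from its lower bound). [folklore] -/
theorem stub_unitarityFromInfraredBound :
    ∀ κ ε C : ℝ, 0 < ε → (∀ᶠ x : Literature.Probability.LatticeModels.Site 3 in Filter.cofinite, |(∑ i, ((x i : ℝ)) ^ 2) * (((∑ i : Fin 3, (Literature.Probability.LatticeModels.criticalTwoPoint 3 (x + Pi.single i 1) + Literature.Probability.LatticeModels.criticalTwoPoint 3 (x - Pi.single i 1))) - 6 * Literature.Probability.LatticeModels.criticalTwoPoint 3 x) / Literature.Probability.LatticeModels.criticalTwoPoint 3 x) - κ| ≤ C * Real.sqrt (∑ i, ((x i : ℝ)) ^ 2) ^ (-ε)) → 0 ≤ κ := by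
  intro κ ε C hε hev
  by_contra hκ
  push Not at hκ
  obtain ⟨c₀, C₀, hc₀, hb⟩ := criticalTwoPoint_bounds_holds (d := 3) le_rfl
  have hGpos : ∀ x : Site 3, x ≠ 0 → 0 < criticalTwoPoint 3 x := fun x hx => by
    have h := (hb x hx).1
    have : 0 < c₀ * ‖x‖ ^ (-(((3 : ℕ) : ℝ) - 1)) :=
      mul_pos hc₀ (Real.rpow_pos_of_pos (PerfectScreening.norm_pos_of_ne_zero hx) _)
    linarith
  have hGup : ∀ x : Site 3, x ≠ 0 → criticalTwoPoint 3 x ≤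
      (|C₀| * Real.sqrt 3) * (∑ i, ((x i : ℤ) : ℝ) ^ 2) ^ (-(1 / 2 : ℝ)) := by
    intro x hx
    have h := (hb x hx).2
    have hn : 0 < ‖x‖ := PerfectScreening.norm_pos_of_ne_zero hx
    rw [show -(((3 : ℕ) : ℝ) - 2) = (-1 : ℝ) by norm_num, Real.rpow_neg_one] at h
    calc criticalTwoPoint 3 x ≤ C₀ * ‖x‖⁻¹ := h
      _ ≤ |C₀| * ‖x‖⁻¹ := mul_le_mul_of_nonneg_right (le_abs_self _) (inv_nonneg.2 hn.le)
      _ ≤ |C₀| * (Real.sqrt 3 * (∑ i, ((x i : ℤ) : ℝ) ^ 2) ^ (-(1 / 2 : ℝ))) :=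
          mul_le_mul_of_nonneg_left (inv_norm_le_sqrt_three_mul_rpow hx) (abs_nonneg _)
      _ = (|C₀| * Real.sqrt 3) * (∑ i, ((x i : ℤ) : ℝ) ^ 2) ^ (-(1 / 2 : ℝ)) := by ring
  -- the coupling `k`
  set k : ℝ := min (-κ / 2) (1 / 8) with hk
  have hk0 : 0 < k := by
    rw [hk]
    exact lt_min (by linarith) (by norm_num)
  have hk8 : k ≤ 1 / 8 := min_le_right _ _
  have hkκ : κ ≤ -2 * k := by
    have : k ≤ -κ / 2 := min_le_left _ _
    linarith
  -- far out: the telemetry bound, `x ≠ 0`, and `|C| s^{-ε/2} ≤ k`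
  have hsmall : ∀ᶠ x : Site 3 in cofinite, |C| * (∑ i, ((x i : ℤ) : ℝ) ^ 2) ^ (-(ε / 2)) ≤ k :=
    tendsto_sumSq_cofinite.eventually (eventually_mul_rpow_neg_le (half_pos hε) |C| hk0)
  have hne : ∀ᶠ x : Site 3 in cofinite, x ≠ 0 := by
    refine Filter.eventually_cofinite.2 ((Set.finite_singleton (0 : Site 3)).subset ?_)
    intro x hx
    simp only [Set.mem_setOf_eq, not_not] at hx
    exact hx
  have hgood : ∀ᶠ x : Site 3 in cofinite, latticeLaplacianZd (criticalTwoPoint 3) x ≤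
      -(k / ∑ i, ((x i : ℤ) : ℝ) ^ 2) * criticalTwoPoint 3 x := by
    filter_upwards [hev, hsmall, hne] with x hT hC hx0
    have hS1 : (1 : ℝ) ≤ ∑ i, ((x i : ℤ) : ℝ) ^ 2 := PerfectScreening.one_le_sum_sq hx0
    have hS0 : (0 : ℝ) < ∑ i, ((x i : ℤ) : ℝ) ^ 2 := by linarith
    have hG0 := hGpos x hx0
    have e2 : Real.sqrt (∑ i, ((x i : ℤ) : ℝ) ^ 2) ^ (-ε) =
        (∑ i, ((x i : ℤ) : ℝ) ^ 2) ^ (-(ε / 2)) := by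
      rw [Real.sqrt_eq_rpow, ← Real.rpow_mul hS0.le]; congr 1; ring
    rw [e2] at hT
    rw [latticeLaplacianZd_three]
    set L : ℝ := (∑ i : Fin 3, (criticalTwoPoint 3 (x + Pi.single i 1) +
      criticalTwoPoint 3 (x - Pi.single i 1))) - 6 * criticalTwoPoint 3 x with hL
    set σ : ℝ := ∑ i, ((x i : ℤ) : ℝ) ^ 2 with hσ
    obtain ⟨-, hT2⟩ := abs_le.1 hT
    have hCabs : C * σ ^ (-(ε / 2)) ≤ |C| * σ ^ (-(ε / 2)) :=
      mul_le_mul_of_nonneg_right (le_abs_self _) (Real.rpow_nonneg hS0.le _)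
    have h1 : σ * (L / criticalTwoPoint 3 x) ≤ -k := by linarith
    have h2 : L / criticalTwoPoint 3 x ≤ -k / σ := by
      rw [le_div_iff₀ hS0]; linarith
    have h3 : L ≤ -k / σ * criticalTwoPoint 3 x := by
      rwa [div_le_iff₀ hG0] at h2
    calc L ≤ -k / σ * criticalTwoPoint 3 x := h3
      _ = -(k / σ) * criticalTwoPoint 3 x := by rw [neg_div]
  -- a threshold `S` beyond the finite exceptional set
  obtain ⟨S, hS⟩ : ∃ S : ℝ, ∀ x : Site 3, S ≤ ∑ i, ((x i : ℤ) : ℝ) ^ 2 →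
      latticeLaplacianZd (criticalTwoPoint 3) x ≤
        -(k / ∑ i, ((x i : ℤ) : ℝ) ^ 2) * criticalTwoPoint 3 x := by
    have hF := Filter.eventually_cofinite.1 hgood
    obtain ⟨B, hB⟩ := (hF.image fun x : Site 3 => ∑ i, ((x i : ℤ) : ℝ) ^ 2).bddAbove
    refine ⟨B + 1, fun x hx => ?_⟩
    by_contra hxP
    have hxF : x ∈ {x : Site 3 | ¬ latticeLaplacianZd (criticalTwoPoint 3) x ≤
        -(k / ∑ i, ((x i : ℤ) : ℝ) ^ 2) * criticalTwoPoint 3 x} := hxP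
    have hle : (∑ i, ((x i : ℤ) : ℝ) ^ 2) ≤ B := hB (Set.mem_image_of_mem _ hxF)
    linarith
  exact no_negative_coupling hk0 hk8 hGpos hGup hS

end Summit.CriticalPhenomena.Ising3DConformalLimit.Theorems
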